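import Literature.Analysis.Hypoelliptic.Pairing
import Literature.Analysis.Hypoelliptic.Multipliers
import HarnessLib

/-!
# Symbolic Fourier-side operators: the algebra of Kohn's proof

Analysis/Hypoelliptic support file, sixth piece of the Fourier-side toolkit serving the
discharge of `Literature.Analysis.Distribution.Hormander1967_thm11` by Kohn's method
(M. Taylor, *Pseudodifferential Operators* (1981), Ch. XV §1).

The operators manipulated in Kohn's proof — vector fields `X_j`, their brackets, the
Bessel potentials `Λ^b = ⟨D⟩^b`, multiplications by smooth functions, their products, and the
commutators `[X, Λ^b]`, `[Y, [X, Λ^b]]` — are recorded here as SYMBOLIC EXPRESSIONS `Sym V`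
over the Fourier-side primitives of the previous files:

* `bessel b` — multiplication by `⟨ξ⟩^b` (`Λ^b`); `lin v` — multiplication by `2πi⟪ξ, v⟫`
  (`∂_v`); `cmul c` — a constant; `conv θ` — `kerOp (convKer θ)` (multiplication by `𝓕⁻¹θ` on
  the `x`-side); `gcomm1 b θ` — the first-gain kernel `kerOp (commConvKer ⟨·⟩^b θ)` of
  `[Λ^b, conv θ]` (order `b - 1`); `gcomm2 b θ' θ` — the second-gain kernel
  `kerOp (dcommKer θ' θ ⟨·⟩^b)` of `[conv θ', [Λ^b, conv θ]]` (order `b - 2`);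
  closed under `smul`, `add`, `comp`.
* `Sym.apply s F` is the action on functions (composition is composition BY DEFINITION),
  `Sym.ord s` the order, `Sym.Cert s` the side condition that every `θ` occurring is rapidly
  decreasing.
* PROVED by structural induction: certified expressions preserve the class `Nice`
  (`⋂_t Ĥ^t`), act linearly on it, and **an expression of order `m` is bounded from `Ĥ^t` to
  `Ĥ^{t-m}` for every `t`** (`Sym.Cert.bound`); the **adjoint** `Sym.adj` of a gain-free
  ("plain") expression satisfies `pairing (s.apply F) G = pairing F (s.adj.apply G)`.
* `Sym.Equiv s t` (`s ≈ t`: same action on `Nice`) with its congruence rules, and the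
  algebraic laws (associativity is definitional; distributivity and the Leibniz rules for
  commutators need linearity, i.e. `Cert`).

## References

* M. E. Taylor, *Pseudodifferential Operators* (1981), Ch. II; Ch. XV §1.
-/

noncomputable section

open MeasureTheory Set Filter Function
open scoped ENNReal NNReal Topology ComplexConjugate InnerProductSpace

namespace Literature.Analysis.Hypoelliptic

/-! ### The expressions, their order -/

section Syntax

variable (V : Type*)

/-- **Symbolic Fourier-side operators** (see the module docstring for the meaning of the
constructors). [folklore] -/
inductive Sym : Type _
  | bessel (b : ℝ) : Sym
  | lin (v : V) : Sym
  | cmul (c : ℂ) : Sym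
  | conv (θ : V → ℂ) : Sym
  | gcomm1 (b : ℝ) (θ : V → ℂ) : Sym
  | gcomm2 (b : ℝ) (θ' θ : V → ℂ) : Sym
  | smul (c : ℂ) (s : Sym) : Sym
  | add (s t : Sym) : Sym
  | comp (s t : Sym) : Sym

variable {V}

namespace Sym

/-- **The order** of a symbolic operator. [folklore] -/
def ord : Sym V → ℝ
  | bessel b => b
  | lin _ => 1
  | cmul _ => 0
  | conv _ => 0
  | gcomm1 b _ => b - 1
  | gcomm2 b _ _ => b - 2
  | smul _ s => ord s
  | add s t => max (ord s) (ord t)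
  | comp s t => ord s + ord t

/-- Negation. [folklore] -/
def neg (s : Sym V) : Sym V := smul (-1) s

/-- Subtraction. [folklore] -/
def sub (s t : Sym V) : Sym V := add s (neg t)

/-- The zero operator. [folklore] -/
def zero : Sym V := cmul 0

/-- The commutator `[s, t] = s t - t s`. [folklore] -/
def comm (s t : Sym V) : Sym V := sub (comp s t) (comp t s)

/-- Finite sums of expressions (no trailing zero for nonempty lists, so that the order of a
nonempty sum is the maximum of the orders). [folklore] -/
def sum : List (Sym V) → Sym V
  | [] => zero
  | [s] => s
  | s :: t :: l => add s (sum (t :: l))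

/-- (structural lemma) [folklore] -/
@[simp] theorem sum_nil : sum ([] : List (Sym V)) = zero := rfl
/-- (structural lemma) [folklore] -/
@[simp] theorem sum_singleton (s : Sym V) : sum [s] = s := rfl
/-- (structural lemma) [folklore] -/
theorem sum_cons_cons (s t : Sym V) (l : List (Sym V)) :
    sum (s :: t :: l) = add s (sum (t :: l)) := rfl

/-- The order of a nonempty sum is bounded by any common bound of the orders. [folklore] -/
theorem ord_sum_le : ∀ {l : List (Sym V)} {m : ℝ}, l ≠ [] → (∀ s ∈ l, ord s ≤ m) →
    ord (sum l) ≤ m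
  | [], _, h, _ => (h rfl).elim
  | [s], _, _, h => h s (List.mem_singleton_self s)
  | s :: t :: l, m, _, h => by
    rw [sum_cons_cons, ord]
    exact max_le (h s List.mem_cons_self)
      (ord_sum_le (l := t :: l) (List.cons_ne_nil t l) fun u hu => h u (List.mem_cons_of_mem _ hu))

/-- (structural lemma) [folklore] -/
@[simp] theorem ord_bessel (b : ℝ) : ord (bessel b : Sym V) = b := rfl
/-- (structural lemma) [folklore] -/
@[simp] theorem ord_lin (v : V) : ord (lin v) = 1 := rfl
/-- (structural lemma) [folklore] -/
@[simp] theorem ord_cmul (c : ℂ) : ord (cmul c : Sym V) = 0 := rfl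
/-- (structural lemma) [folklore] -/
@[simp] theorem ord_conv (θ : V → ℂ) : ord (conv θ) = 0 := rfl
/-- (structural lemma) [folklore] -/
@[simp] theorem ord_gcomm1 (b : ℝ) (θ : V → ℂ) : ord (gcomm1 b θ) = b - 1 := rfl
/-- (structural lemma) [folklore] -/
@[simp] theorem ord_gcomm2 (b : ℝ) (θ' θ : V → ℂ) : ord (gcomm2 b θ' θ) = b - 2 := rfl
/-- (structural lemma) [folklore] -/
@[simp] theorem ord_smul (c : ℂ) (s : Sym V) : ord (smul c s) = ord s := rfl
/-- (structural lemma) [folklore] -/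
@[simp] theorem ord_add (s t : Sym V) : ord (add s t) = max (ord s) (ord t) := rfl
/-- (structural lemma) [folklore] -/
@[simp] theorem ord_comp (s t : Sym V) : ord (comp s t) = ord s + ord t := rfl
/-- (structural lemma) [folklore] -/
@[simp] theorem ord_neg (s : Sym V) : ord (neg s) = ord s := rfl
/-- (structural lemma) [folklore] -/
@[simp] theorem ord_sub (s t : Sym V) : ord (sub s t) = max (ord s) (ord t) := rfl
/-- (structural lemma) [folklore] -/
@[simp] theorem ord_zero : ord (zero : Sym V) = 0 := rfl
/-- (structural lemma) [folklore] -/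
@[simp] theorem ord_comm (s t : Sym V) :
    ord (comm s t) = max (ord s + ord t) (ord t + ord s) := rfl

end Sym

end Syntax

/-! ### The side condition -/

section CertSec

variable {V : Type*} [NormedAddCommGroup V] [MeasurableSpace V]

namespace Sym

/-- **The side condition**: every `θ` occurring in the expression is rapidly decreasing.
[folklore] -/
def Cert : Sym V → Prop
  | bessel _ => True
  | lin _ => True
  | cmul _ => True
  | conv θ => ∃ D, RapidDecay θ D
  | gcomm1 _ θ => ∃ D, RapidDecay θ D
  | gcomm2 _ θ' θ => (∃ D, RapidDecay θ' D) ∧ ∃ D, RapidDecay θ D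
  | smul _ s => Cert s
  | add s t => Cert s ∧ Cert t
  | comp s t => Cert s ∧ Cert t

/-- (structural lemma) [folklore] -/
@[simp] theorem cert_bessel (b : ℝ) : Cert (bessel b : Sym V) := trivial
/-- (structural lemma) [folklore] -/
@[simp] theorem cert_lin (v : V) : Cert (lin v) := trivial
/-- (structural lemma) [folklore] -/
@[simp] theorem cert_cmul (c : ℂ) : Cert (cmul c : Sym V) := trivial
/-- (structural lemma) [folklore] -/
@[simp] theorem cert_conv_iff (θ : V → ℂ) : Cert (conv θ) ↔ ∃ D, RapidDecay θ D := Iff.rfl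
/-- (structural lemma) [folklore] -/
@[simp] theorem cert_gcomm1_iff (b : ℝ) (θ : V → ℂ) :
    Cert (gcomm1 b θ) ↔ ∃ D, RapidDecay θ D := Iff.rfl
/-- (structural lemma) [folklore] -/
@[simp] theorem cert_gcomm2_iff (b : ℝ) (θ' θ : V → ℂ) :
    Cert (gcomm2 b θ' θ) ↔ (∃ D, RapidDecay θ' D) ∧ ∃ D, RapidDecay θ D := Iff.rfl
/-- (structural lemma) [folklore] -/
@[simp] theorem cert_smul_iff (c : ℂ) (s : Sym V) : Cert (smul c s) ↔ Cert s := Iff.rfl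
/-- (structural lemma) [folklore] -/
@[simp] theorem cert_add_iff (s t : Sym V) : Cert (add s t) ↔ Cert s ∧ Cert t := Iff.rfl
/-- (structural lemma) [folklore] -/
@[simp] theorem cert_comp_iff (s t : Sym V) : Cert (comp s t) ↔ Cert s ∧ Cert t := Iff.rfl
/-- (structural lemma) [folklore] -/
@[simp] theorem cert_neg_iff (s : Sym V) : Cert (neg s) ↔ Cert s := Iff.rfl
/-- (structural lemma) [folklore] -/
@[simp] theorem cert_sub_iff (s t : Sym V) : Cert (sub s t) ↔ Cert s ∧ Cert t := Iff.rfl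
/-- (structural lemma) [folklore] -/
@[simp] theorem cert_zero : Cert (zero : Sym V) := trivial
/-- (structural lemma) [folklore] -/
@[simp] theorem cert_comm_iff (s t : Sym V) : Cert (comm s t) ↔ Cert s ∧ Cert t := by
  simp only [comm, sub, neg, cert_add_iff, cert_comp_iff, cert_smul_iff]
  tauto

/-- (structural lemma) [folklore] -/
theorem cert_sum : ∀ {l : List (Sym V)}, (∀ s ∈ l, Cert s) → Cert (sum l)
  | [], _ => cert_zero
  | [s], h => h s (List.mem_singleton_self s)
  | s :: t :: l, h => by
    rw [sum_cons_cons, cert_add_iff]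
    exact ⟨h s List.mem_cons_self,
      cert_sum (l := t :: l) fun u hu => h u (List.mem_cons_of_mem _ hu)⟩

end Sym

/-- `θ†(ζ) = conj (θ (-ζ))`: the convolution kernel of the adjoint, `(convKer θ)† = convKer θ†`
(for `θ = 𝓕a` with `a` real, `θ† = θ`). [folklore] -/
def reflConj (θ : V → ℂ) (ζ : V) : ℂ :=
  conj (θ (-ζ))

/-- `θ†` is rapidly decreasing with the same constants. [folklore] -/
theorem RapidDecay.reflConj {θ : V → ℂ} {D : ℕ → ℝ} [MeasurableNeg V] (h : RapidDecay θ D) :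
    RapidDecay (reflConj θ) D where
  measurable := (Complex.continuous_conj.measurable.comp (h.measurable.comp measurable_neg) : _)
  nonneg := h.nonneg
  bound N ζ := by
    simp only [Literature.Analysis.Hypoelliptic.reflConj, Complex.norm_conj]
    simpa using h.bound N (-ζ)

omit [MeasurableSpace V] in
/-- `adjKer (convKer θ) = convKer θ†`. [folklore] -/
theorem adjKer_convKer (θ : V → ℂ) : adjKer (convKer θ) = convKer (reflConj θ) := by
  ext ξ η
  simp [adjKer, convKer, reflConj, neg_sub]

omit [MeasurableSpace V] in
/-- The Bessel multiplier as a complex function. [folklore] -/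
def Sym.bwC (b : ℝ) (ξ : V) : ℂ := (bw b ξ : ℂ)

omit [MeasurableSpace V] in
/-- Unfolding `bwC`. [folklore] -/
@[simp] theorem Sym.bwC_apply (b : ℝ) (ξ : V) : Sym.bwC b ξ = (bw b ξ : ℂ) := rfl

end CertSec

/-! ### The action -/

variable {V : Type*} [NormedAddCommGroup V] [InnerProductSpace ℝ V] [FiniteDimensional ℝ V]
  [MeasurableSpace V] [BorelSpace V]

namespace Sym

/-- **The action** of a symbolic operator on functions `V → ℂ` (composition is composition by
definition). [folklore] -/
def apply : Sym V → (V → ℂ) → (V → ℂ)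
  | bessel b, F => fun ξ => bwC b ξ * F ξ
  | lin v, F => fun ξ => linMul v ξ * F ξ
  | cmul c, F => fun ξ => c * F ξ
  | conv θ, F => kerOp (convKer θ) F
  | gcomm1 b θ, F => kerOp (commConvKer (bwC b) θ) F
  | gcomm2 b θ' θ, F => kerOp (dcommKer θ' θ (bwC b)) F
  | smul c s, F => fun ξ => c * apply s F ξ
  | add s t, F => fun ξ => apply s F ξ + apply t F ξ
  | comp s t, F => apply s (apply t F)

section Unfold

variable (F : V → ℂ)

/-- (structural lemma) [folklore] -/
@[simp] theorem apply_bessel (b : ℝ) : apply (bessel b) F = fun ξ => bwC b ξ * F ξ := rfl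
/-- (structural lemma) [folklore] -/
@[simp] theorem apply_lin (v : V) : apply (lin v) F = fun ξ => linMul v ξ * F ξ := rfl
/-- (structural lemma) [folklore] -/
@[simp] theorem apply_cmul (c : ℂ) : apply (cmul c) F = fun ξ => c * F ξ := rfl
/-- (structural lemma) [folklore] -/
@[simp] theorem apply_conv (θ : V → ℂ) : apply (conv θ) F = kerOp (convKer θ) F := rfl
/-- (structural lemma) [folklore] -/
@[simp] theorem apply_gcomm1 (b : ℝ) (θ : V → ℂ) :
    apply (gcomm1 b θ) F = kerOp (commConvKer (bwC b) θ) F := rfl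
/-- (structural lemma) [folklore] -/
@[simp] theorem apply_gcomm2 (b : ℝ) (θ' θ : V → ℂ) :
    apply (gcomm2 b θ' θ) F = kerOp (dcommKer θ' θ (bwC b)) F := rfl
/-- (structural lemma) [folklore] -/
@[simp] theorem apply_smul (c : ℂ) (s : Sym V) :
    apply (smul c s) F = fun ξ => c * apply s F ξ := rfl
/-- (structural lemma) [folklore] -/
@[simp] theorem apply_add (s t : Sym V) :
    apply (add s t) F = fun ξ => apply s F ξ + apply t F ξ := rfl
/-- (structural lemma) [folklore] -/
@[simp] theorem apply_comp (s t : Sym V) : apply (comp s t) F = apply s (apply t F) := rfl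
/-- (structural lemma) [folklore] -/
@[simp] theorem apply_neg (s : Sym V) : apply (neg s) F = fun ξ => -apply s F ξ := by
  ext ξ; simp [neg]
/-- (structural lemma) [folklore] -/
@[simp] theorem apply_sub (s t : Sym V) :
    apply (sub s t) F = fun ξ => apply s F ξ - apply t F ξ := by
  ext ξ; simp [sub, neg, apply, sub_eq_add_neg]
/-- (structural lemma) [folklore] -/
@[simp] theorem apply_zero : apply (zero : Sym V) F = fun _ => 0 := by
  ext ξ; simp [zero]
/-- (structural lemma) [folklore] -/
@[simp] theorem apply_comm (s t : Sym V) :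
    apply (comm s t) F = fun ξ => apply s (apply t F) ξ - apply t (apply s F) ξ := by
  simp [comm]

/-- The action of a finite sum. [folklore] -/
theorem apply_sum : ∀ (l : List (Sym V)),
    apply (sum l) F = fun ξ => (l.map fun s => apply s F ξ).sum
  | [] => by ext ξ; simp
  | [s] => by ext ξ; simp
  | s :: t :: l => by
    ext ξ
    rw [sum_cons_cons, apply_add]
    simp only [apply_sum (t :: l), List.map_cons, List.sum_cons]

end Unfold

/-! ### Kernel certificates of the primitives -/

/-- The first-gain kernel is of order `b - 1`. [folklore] -/
theorem kerDecay_gcomm1 (b : ℝ) {θ : V → ℂ} {D : ℕ → ℝ} (h : RapidDecay θ D) :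
    ∃ C, KerDecay (commConvKer (bwC (V := V) b) θ) (b - 1) C :=
  ⟨_, (mulDiff_bw b).kerDecay_commConvKer h⟩

/-- The second-gain kernel is of order `b - 2`. [folklore] -/
theorem kerDecay_gcomm2 (b : ℝ) {θ' θ : V → ℂ} {D' D : ℕ → ℝ} (h' : RapidDecay θ' D')
    (h : RapidDecay θ D) : ∃ C, KerDecay (dcommKer θ' θ (bwC (V := V) b)) (b - 2) C :=
  ⟨_, (mulDiff2_bw b).kerDecay_dcommKer h' h⟩

/-! ### `Nice` is preserved -/

/-- **Certified expressions preserve the class `Nice`.** [folklore] -/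
theorem Cert.nice_apply : ∀ {s : Sym V}, Cert s → ∀ {F : V → ℂ}, Nice F → Nice (apply s F)
  | bessel b, _, F, hF => (mulBound_bw b).nice_mul hF
  | lin v, _, F, hF => (mulBound_linMul v).nice_mul hF
  | cmul c, _, F, hF => hF.const_mul c
  | conv θ, ⟨D, hθ⟩, F, hF => hθ.kerDecay_convKer.nice_kerOp hF
  | gcomm1 b θ, ⟨D, hθ⟩, F, hF => by
    obtain ⟨C, hK⟩ := kerDecay_gcomm1 (V := V) b hθ
    exact hK.nice_kerOp hF
  | gcomm2 b θ' θ, ⟨⟨D', hθ'⟩, ⟨D, hθ⟩⟩, F, hF => by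
    obtain ⟨C, hK⟩ := kerDecay_gcomm2 (V := V) b hθ' hθ
    exact hK.nice_kerOp hF
  | smul c s, hs, F, hF => (Cert.nice_apply (s := s) hs hF).const_mul c
  | add s t, ⟨hs, ht⟩, F, hF => (Cert.nice_apply hs hF).add (Cert.nice_apply ht hF)
  | comp s t, ⟨hs, ht⟩, F, hF => Cert.nice_apply hs (Cert.nice_apply ht hF)

/-! ### Linearity on `Nice` -/

/-- Scalars pass through every expression (no side condition). [folklore] -/
theorem apply_const_mul : ∀ (s : Sym V) (c : ℂ) (F : V → ℂ),
    apply s (fun ξ => c * F ξ) = fun ξ => c * apply s F ξ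
  | bessel b, c, F => by ext ξ; simp only [apply_bessel]; ring
  | lin v, c, F => by ext ξ; simp only [apply_lin]; ring
  | cmul c', c, F => by ext ξ; simp only [apply_cmul]; ring
  | conv θ, c, F => kerOp_const_mul _ c F
  | gcomm1 b θ, c, F => kerOp_const_mul _ c F
  | gcomm2 b θ' θ, c, F => kerOp_const_mul _ c F
  | smul c' s, c, F => by ext ξ; simp only [apply_smul]; rw [apply_const_mul s c F]; ring
  | add s t, c, F => by
    ext ξ; simp only [apply_add]; rw [apply_const_mul s c F, apply_const_mul t c F]; ring
  | comp s t, c, F => by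
    simp only [apply_comp]; rw [apply_const_mul t c F, apply_const_mul s c]

/-- Every expression kills the zero function. [folklore] -/
theorem apply_zero_fun : ∀ (s : Sym V), apply s (fun _ => (0 : ℂ)) = fun _ => 0
  | bessel b => by ext ξ; simp
  | lin v => by ext ξ; simp
  | cmul c => by ext ξ; simp
  | conv θ => by ext ξ; simp [kerOp]
  | gcomm1 b θ => by ext ξ; simp [kerOp]
  | gcomm2 b θ' θ => by ext ξ; simp [kerOp]
  | smul c s => by ext ξ; simp only [apply_smul]; rw [apply_zero_fun s]; simp
  | add s t => by ext ξ; simp only [apply_add]; rw [apply_zero_fun s, apply_zero_fun t]; simp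
  | comp s t => by simp only [apply_comp]; rw [apply_zero_fun t, apply_zero_fun s]

/-- **Additivity on `Nice`.** [folklore] -/
theorem Cert.apply_add_fun : ∀ {s : Sym V}, Cert s → ∀ {F G : V → ℂ}, Nice F → Nice G →
    apply s (fun ξ => F ξ + G ξ) = fun ξ => apply s F ξ + apply s G ξ
  | bessel b, _, F, G, _, _ => by ext ξ; simp only [apply_bessel]; ring
  | lin v, _, F, G, _, _ => by ext ξ; simp only [apply_lin]; ring
  | cmul c, _, F, G, _, _ => by ext ξ; simp only [apply_cmul]; ring
  | conv θ, ⟨D, hθ⟩, F, G, hF, hG => hθ.kerDecay_convKer.kerOp_add (hF.inH 0) (hG.inH 0)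
  | gcomm1 b θ, ⟨D, hθ⟩, F, G, hF, hG => by
    obtain ⟨C, hK⟩ := kerDecay_gcomm1 (V := V) b hθ
    exact hK.kerOp_add (hF.inH 0) (hG.inH 0)
  | gcomm2 b θ' θ, ⟨⟨D', hθ'⟩, ⟨D, hθ⟩⟩, F, G, hF, hG => by
    obtain ⟨C, hK⟩ := kerDecay_gcomm2 (V := V) b hθ' hθ
    exact hK.kerOp_add (hF.inH 0) (hG.inH 0)
  | smul c s, hs, F, G, hF, hG => by
    ext ξ; simp only [apply_smul]; rw [Cert.apply_add_fun (s := s) hs hF hG]; ring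
  | add s t, ⟨hs, ht⟩, F, G, hF, hG => by
    ext ξ; simp only [apply_add]
    rw [Cert.apply_add_fun hs hF hG, Cert.apply_add_fun ht hF hG]; ring
  | comp s t, ⟨hs, ht⟩, F, G, hF, hG => by
    simp only [apply_comp]
    rw [Cert.apply_add_fun ht hF hG,
      Cert.apply_add_fun hs (Cert.nice_apply ht hF) (Cert.nice_apply ht hG)]

/-- Negation passes through. [folklore] -/
theorem apply_neg_fun (s : Sym V) (F : V → ℂ) :
    apply s (fun ξ => -F ξ) = fun ξ => -apply s F ξ := by
  have h := apply_const_mul s (-1) F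
  simp only [neg_mul, one_mul] at h
  exact h

/-- **Subtractivity on `Nice`.** [folklore] -/
theorem Cert.apply_sub_fun {s : Sym V} (hs : Cert s) {F G : V → ℂ} (hF : Nice F) (hG : Nice G) :
    apply s (fun ξ => F ξ - G ξ) = fun ξ => apply s F ξ - apply s G ξ := by
  have h := Cert.apply_add_fun hs hF hG.neg
  rw [apply_neg_fun] at h
  simp only [← sub_eq_add_neg] at h
  exact h

/-! ### Boundedness: order `m` maps `Ĥ^t` to `Ĥ^{t-m}` -/

/-- **An expression of order `m` is bounded from `Ĥ^t` to `Ĥ^{t-m}` for every `t`** (on the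
class `Nice`; constants existential). [folklore] -/
theorem Cert.bound : ∀ {s : Sym V}, Cert s → ∀ t : ℝ, ∃ C : ℝ, 0 ≤ C ∧ ∀ F : V → ℂ, Nice F →
    wnorm (t - ord s) (apply s F) ≤ ENNReal.ofReal C * wnorm t F
  | bessel b, _, t => ⟨1, zero_le_one, fun F _ =>
      wnorm_mul_le zero_le_one (mulBound_bw b).bound t F⟩
  | lin v, _, t => ⟨2 * Real.pi * ‖v‖, by positivity, fun F _ =>
      wnorm_mul_le (by positivity) (mulBound_linMul v).bound t F⟩
  | cmul c, _, t => ⟨‖c‖, norm_nonneg c, fun F _ => by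
      have h := wnorm_mul_le (norm_nonneg c) (mulBound_const (V := V) c).bound t F
      simpa using h⟩
  | conv θ, ⟨D, hθ⟩, t => ⟨_, schurConst_nonneg hθ.nonneg _, fun F hF => by
      have h := wnorm_kerOp_le hθ.kerDecay_convKer t hF.1
      simpa using h⟩
  | gcomm1 b θ, ⟨D, hθ⟩, t => by
    obtain ⟨C, hK⟩ := kerDecay_gcomm1 (V := V) b hθ
    exact ⟨_, schurConst_nonneg hK.nonneg _, fun F hF => wnorm_kerOp_le hK t hF.1⟩
  | gcomm2 b θ' θ, ⟨⟨D', hθ'⟩, ⟨D, hθ⟩⟩, t => by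
    obtain ⟨C, hK⟩ := kerDecay_gcomm2 (V := V) b hθ' hθ
    exact ⟨_, schurConst_nonneg hK.nonneg _, fun F hF => wnorm_kerOp_le hK t hF.1⟩
  | smul c s, hs, t => by
    obtain ⟨C, hC, h⟩ := Cert.bound (s := s) hs t
    refine ⟨‖c‖ * C, mul_nonneg (norm_nonneg c) hC, fun F hF => ?_⟩
    rw [apply_smul, ord_smul, wnorm_const_mul, ENNReal.ofReal_mul (norm_nonneg c), ofReal_norm,
      mul_assoc]
    exact mul_le_mul' le_rfl (h F hF)
  | add s s', ⟨hs, hs'⟩, t => by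
    obtain ⟨C, hC, h⟩ := Cert.bound hs t
    obtain ⟨C', hC', h'⟩ := Cert.bound hs' t
    refine ⟨C + C', add_nonneg hC hC', fun F hF => ?_⟩
    rw [apply_add, ord_add, ENNReal.ofReal_add hC hC', add_mul]
    refine (wnorm_add_le (Cert.nice_apply hs hF).1 (Cert.nice_apply hs' hF).1).trans ?_
    exact add_le_add ((wnorm_mono (sub_le_sub_left (le_max_left _ _) _) _).trans (h F hF))
      ((wnorm_mono (sub_le_sub_left (le_max_right _ _) _) _).trans (h' F hF))
  | comp s s', ⟨hs, hs'⟩, t => by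
    obtain ⟨C', hC', h'⟩ := Cert.bound hs' t
    obtain ⟨C, hC, h⟩ := Cert.bound hs (t - ord s')
    refine ⟨C * C', mul_nonneg hC hC', fun F hF => ?_⟩
    rw [apply_comp, ord_comp, show t - (ord s + ord s') = t - ord s' - ord s by ring,
      ENNReal.ofReal_mul hC, mul_assoc]
    exact (h _ (Cert.nice_apply hs' hF)).trans (mul_le_mul' le_rfl (h' F hF))

/-- Real-valued form of the bound (all norms are finite on `Nice`). [folklore] -/
theorem Cert.bound_toReal {s : Sym V} (hs : Cert s) (t : ℝ) : ∃ C : ℝ, 0 ≤ C ∧ ∀ F : V → ℂ,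
    Nice F → (wnorm (t - ord s) (apply s F)).toReal ≤ C * (wnorm t F).toReal := by
  obtain ⟨C, hC, h⟩ := hs.bound t
  refine ⟨C, hC, fun F hF => ?_⟩
  have h1 := h F hF
  rw [← ENNReal.toReal_ofReal hC, ← ENNReal.toReal_mul]
  exact ENNReal.toReal_mono (ENNReal.mul_ne_top ENNReal.ofReal_ne_top (hF.2 t).ne) h1

/-- The bound at an arbitrary pair of levels `t' ≤ t - ord s`. [folklore] -/
theorem Cert.bound_toReal' {s : Sym V} (hs : Cert s) {t t' : ℝ} (ht : t' ≤ t - ord s) :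
    ∃ C : ℝ, 0 ≤ C ∧ ∀ F : V → ℂ, Nice F →
      (wnorm t' (apply s F)).toReal ≤ C * (wnorm t F).toReal := by
  obtain ⟨C, hC, h⟩ := hs.bound_toReal t
  refine ⟨C, hC, fun F hF => (ENNReal.toReal_mono ?_ (wnorm_mono ht _)).trans (h F hF)⟩
  exact ((hs.nice_apply hF).2 _).ne

/-! ### Extensional equivalence -/

/-- `s ≈ t`: the two expressions act identically on `Nice`. [folklore] -/
def Equiv (s t : Sym V) : Prop :=
  ∀ F : V → ℂ, Nice F → apply s F = apply t F

@[inherit_doc] scoped infix:50 " ≈ " => Sym.Equiv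

/-- (structural lemma) [folklore] -/
theorem Equiv.refl (s : Sym V) : s ≈ s := fun _ _ => rfl

/-- (structural lemma) [folklore] -/
theorem Equiv.rfl {s : Sym V} : s ≈ s := Equiv.refl s

/-- (structural lemma) [folklore] -/
theorem Equiv.symm {s t : Sym V} (h : s ≈ t) : t ≈ s := fun F hF => (h F hF).symm

/-- (structural lemma) [folklore] -/
theorem Equiv.trans {s t u : Sym V} (h₁ : s ≈ t) (h₂ : t ≈ u) : s ≈ u :=
  fun F hF => (h₁ F hF).trans (h₂ F hF)

/-- Congruence under `comp` on the right (free). [folklore] -/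
theorem Equiv.comp_right {t t' : Sym V} (h : t ≈ t') (s : Sym V) : comp s t ≈ comp s t' :=
  fun F hF => by simp only [apply_comp, h F hF]

/-- Congruence under `comp` on the left (the inner expression must be certified). [folklore] -/
theorem Equiv.comp_left {s s' : Sym V} (h : s ≈ s') {t : Sym V} (ht : Cert t) :
    comp s t ≈ comp s' t :=
  fun F hF => by simp only [apply_comp, h _ (ht.nice_apply hF)]

/-- Congruence under `comp` on both sides. [folklore] -/
theorem Equiv.comp {s s' t t' : Sym V} (hs : s ≈ s') (ht : t ≈ t') (hct : Cert t) :
    comp s t ≈ comp s' t' :=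
  (hs.comp_left hct).trans (ht.comp_right s')

/-- Congruence under `add`. [folklore] -/
theorem Equiv.add {s s' t t' : Sym V} (hs : s ≈ s') (ht : t ≈ t') : add s t ≈ add s' t' :=
  fun F hF => by simp only [apply_add, hs F hF, ht F hF]

/-- Congruence under `smul`. [folklore] -/
theorem Equiv.smul {s s' : Sym V} (hs : s ≈ s') (c : ℂ) : smul c s ≈ smul c s' :=
  fun F hF => by simp only [apply_smul, hs F hF]

/-- Congruence under `neg`. [folklore] -/
theorem Equiv.neg {s s' : Sym V} (hs : s ≈ s') : neg s ≈ neg s' := hs.smul (-1)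

/-- Congruence under `sub`. [folklore] -/
theorem Equiv.sub {s s' t t' : Sym V} (hs : s ≈ s') (ht : t ≈ t') : sub s t ≈ sub s' t' :=
  hs.add ht.neg

/-- Congruence under `comm` (both certified). [folklore] -/
theorem Equiv.comm {s s' t t' : Sym V} (hs : s ≈ s') (ht : t ≈ t') (hcs : Cert s) (hct : Cert t) :
    comm s t ≈ comm s' t' :=
  (hs.comp ht hct).sub (ht.comp hs hcs)

/-- Certified equivalent expressions have the same bounds: transport of `Cert.bound_toReal'`
along `≈`. [folklore] -/
theorem Equiv.bound_toReal' {s s' : Sym V} (h : s ≈ s') (hs' : Cert s') {t t' : ℝ}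
    (ht : t' ≤ t - ord s') :
    ∃ C : ℝ, 0 ≤ C ∧ ∀ F : V → ℂ, Nice F →
      (wnorm t' (apply s F)).toReal ≤ C * (wnorm t F).toReal := by
  obtain ⟨C, hC, hb⟩ := hs'.bound_toReal' ht
  exact ⟨C, hC, fun F hF => by rw [h F hF]; exact hb F hF⟩

/-! ### Algebraic laws -/

/-- Associativity of composition is definitional. [folklore] -/
theorem comp_assoc (s t u : Sym V) : comp (comp s t) u ≈ comp s (comp t u) := fun _ _ => rfl

/-- Right distributivity is definitional. [folklore] -/
theorem comp_add_right (s t u : Sym V) : comp (add s t) u ≈ add (comp s u) (comp t u) :=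
  fun _ _ => rfl

/-- Left distributivity (on `Nice`). [folklore] -/
theorem comp_add_left {s : Sym V} (hs : Cert s) {t u : Sym V} (ht : Cert t) (hu : Cert u) :
    comp s (add t u) ≈ add (comp s t) (comp s u) :=
  fun F hF => by
    simp only [apply_comp, apply_add]
    exact hs.apply_add_fun (ht.nice_apply hF) (hu.nice_apply hF)

/-- Scalars on the right of a composition. [folklore] -/
theorem comp_smul_right (s t : Sym V) (c : ℂ) : comp s (smul c t) ≈ smul c (comp s t) :=
  fun F _ => by simp only [apply_comp, apply_smul]; exact apply_const_mul s c _

/-- Scalars on the left of a composition (definitional). [folklore] -/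
theorem comp_smul_left (s t : Sym V) (c : ℂ) : comp (smul c s) t ≈ smul c (comp s t) :=
  fun _ _ => rfl

/-- Negation on the right of a composition. [folklore] -/
theorem comp_neg_right (s t : Sym V) : comp s (neg t) ≈ neg (comp s t) :=
  comp_smul_right s t (-1)

/-- Negation on the left of a composition (definitional). [folklore] -/
theorem comp_neg_left (s t : Sym V) : comp (neg s) t ≈ neg (comp s t) := fun _ _ => rfl

/-- Left subtractivity (on `Nice`). [folklore] -/
theorem comp_sub_left {s : Sym V} (hs : Cert s) {t u : Sym V} (ht : Cert t) (hu : Cert u) :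
    comp s (sub t u) ≈ sub (comp s t) (comp s u) :=
  fun F hF => by
    simp only [apply_comp, apply_sub]
    exact hs.apply_sub_fun (ht.nice_apply hF) (hu.nice_apply hF)

/-- Right subtractivity is definitional. [folklore] -/
theorem comp_sub_right (s t u : Sym V) : comp (sub s t) u ≈ sub (comp s u) (comp t u) :=
  fun F _ => by ext ξ; simp

/-- (structural lemma) [folklore] -/
theorem add_comm' (s t : Sym V) : add s t ≈ add t s := fun F _ => by
  ext ξ; simp only [apply_add]; ring

/-- (structural lemma) [folklore] -/
theorem add_assoc' (s t u : Sym V) : add (add s t) u ≈ add s (add t u) := fun F _ => by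
  ext ξ; simp only [apply_add]; ring

/-- (structural lemma) [folklore] -/
theorem add_zero' (s : Sym V) : add s zero ≈ s := fun F _ => by
  ext ξ; simp

/-- (structural lemma) [folklore] -/
theorem zero_add' (s : Sym V) : add zero s ≈ s := fun F _ => by
  ext ξ; simp

/-- (structural lemma) [folklore] -/
theorem sub_self' (s : Sym V) : sub s s ≈ zero := fun F _ => by
  ext ξ; simp

/-- (structural lemma) [folklore] -/
theorem neg_neg' (s : Sym V) : neg (neg s) ≈ s := fun F _ => by
  ext ξ; simp

/-- (structural lemma) [folklore] -/
theorem smul_add' (c : ℂ) (s t : Sym V) : smul c (add s t) ≈ add (smul c s) (smul c t) :=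
  fun F _ => by ext ξ; simp only [apply_smul, apply_add]; ring

/-- (structural lemma) [folklore] -/
theorem smul_smul' (c d : ℂ) (s : Sym V) : smul c (smul d s) ≈ smul (c * d) s :=
  fun F _ => by ext ξ; simp only [apply_smul]; ring

/-- (structural lemma) [folklore] -/
theorem one_smul' (s : Sym V) : smul 1 s ≈ s := fun F _ => by ext ξ; simp

/-- (structural lemma) [folklore] -/
theorem zero_smul' (s : Sym V) : smul 0 s ≈ zero := fun F _ => by ext ξ; simp

/-- (structural lemma) [folklore] -/
theorem comp_zero' (s : Sym V) : comp s zero ≈ zero := fun F _ => by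
  simp only [apply_comp, apply_zero]; exact apply_zero_fun s

/-- (structural lemma) [folklore] -/
theorem zero_comp' (s : Sym V) : comp zero s ≈ zero := fun F _ => by
  ext ξ; simp

/-- `sum (s :: l) ≈ s + sum l` (an equality unless `l = []`). [folklore] -/
theorem sum_cons (s : Sym V) (l : List (Sym V)) : sum (s :: l) ≈ add s (sum l) := by
  cases l with
  | nil => exact (add_zero' s).symm
  | cons t l => exact fun _ _ => rfl

/-! ### Commutator calculus -/

/-- **The Leibniz rule for commutators, composite right factor**:
`[s, t u] = [s, t] u + t [s, u]` (on `Nice`; `t` must act linearly). [folklore] -/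
theorem comm_comp {s t u : Sym V} (hs : Cert s) (ht : Cert t) (hu : Cert u) :
    comm s (comp t u) ≈ add (comp (comm s t) u) (comp t (comm s u)) := by
  intro F hF
  have h := ht.apply_sub_fun (hs.nice_apply (hu.nice_apply hF)) (hu.nice_apply (hs.nice_apply hF))
  ext ξ
  simp only [apply_comm, apply_add, apply_comp]
  rw [h]
  ring

/-- **The Leibniz rule for commutators, composite left factor**:
`[s t, u] = s [t, u] + [s, u] t` (on `Nice`; `s` must act linearly). [folklore] -/
theorem comp_comm {s t u : Sym V} (hs : Cert s) (ht : Cert t) (hu : Cert u) :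
    comm (comp s t) u ≈ add (comp s (comm t u)) (comp (comm s u) t) := by
  intro F hF
  have h := hs.apply_sub_fun (ht.nice_apply (hu.nice_apply hF)) (hu.nice_apply (ht.nice_apply hF))
  ext ξ
  simp only [apply_comm, apply_add, apply_comp]
  rw [h]
  ring

/-- Antisymmetry of the commutator. [folklore] -/
theorem comm_antisymm (s t : Sym V) : comm s t ≈ neg (comm t s) := fun F _ => by
  ext ξ; simp only [apply_comm, apply_neg]; ring

/-- `[s, s] = 0`. [folklore] -/
theorem comm_self (s : Sym V) : comm s s ≈ zero := fun F _ => by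
  ext ξ; simp

/-- Additivity of the commutator on the left (the right factor must act linearly). [folklore] -/
theorem comm_add_left {s t u : Sym V} (hs : Cert s) (ht : Cert t) (hu : Cert u) :
    comm (add s t) u ≈ add (comm s u) (comm t u) := by
  intro F hF
  have h := hu.apply_add_fun (hs.nice_apply hF) (ht.nice_apply hF)
  ext ξ
  simp only [apply_comm, apply_add]
  rw [h]
  ring

/-- Additivity of the commutator on the right (the left factor must act linearly). [folklore] -/
theorem comm_add_right {s t u : Sym V} (hs : Cert s) (ht : Cert t) (hu : Cert u) :
    comm s (add t u) ≈ add (comm s t) (comm s u) := by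
  intro F hF
  have h := hs.apply_add_fun (ht.nice_apply hF) (hu.nice_apply hF)
  ext ξ
  simp only [apply_comm, apply_add]
  rw [h]
  ring

/-- Scalars in the left slot of a commutator. [folklore] -/
theorem comm_smul_left (c : ℂ) (s t : Sym V) : comm (smul c s) t ≈ smul c (comm s t) := by
  intro F _
  ext ξ
  simp only [apply_comm, apply_smul]
  rw [apply_const_mul t c]
  ring

/-- Scalars in the right slot of a commutator. [folklore] -/
theorem comm_smul_right (c : ℂ) (s t : Sym V) : comm s (smul c t) ≈ smul c (comm s t) := by
  intro F _
  ext ξ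
  simp only [apply_comm, apply_smul]
  rw [apply_const_mul s c]
  ring

/-! ### Adjoints of plain expressions -/

section PlainSyntax

omit [NormedAddCommGroup V] [InnerProductSpace ℝ V] [FiniteDimensional ℝ V] [MeasurableSpace V] [BorelSpace V]

/-- Plain expressions: no gain kernels. [folklore] -/
def Plain : Sym V → Prop
  | bessel _ => True
  | lin _ => True
  | cmul _ => True
  | conv _ => True
  | gcomm1 _ _ => False
  | gcomm2 _ _ _ => False
  | smul _ s => Plain s
  | add s t => Plain s ∧ Plain t
  | comp s t => Plain s ∧ Plain t

/-- (structural lemma) [folklore] -/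
@[simp] theorem plain_bessel (b : ℝ) : Plain (bessel b : Sym V) := trivial
/-- (structural lemma) [folklore] -/
@[simp] theorem plain_lin (v : V) : Plain (lin v) := trivial
/-- (structural lemma) [folklore] -/
@[simp] theorem plain_cmul (c : ℂ) : Plain (cmul c : Sym V) := trivial
/-- (structural lemma) [folklore] -/
@[simp] theorem plain_conv (θ : V → ℂ) : Plain (conv θ) := trivial
/-- (structural lemma) [folklore] -/
@[simp] theorem plain_smul_iff (c : ℂ) (s : Sym V) : Plain (smul c s) ↔ Plain s := Iff.rfl
/-- (structural lemma) [folklore] -/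
@[simp] theorem plain_add_iff (s t : Sym V) : Plain (add s t) ↔ Plain s ∧ Plain t := Iff.rfl
/-- (structural lemma) [folklore] -/
@[simp] theorem plain_comp_iff (s t : Sym V) : Plain (comp s t) ↔ Plain s ∧ Plain t := Iff.rfl
/-- (structural lemma) [folklore] -/
@[simp] theorem plain_neg_iff (s : Sym V) : Plain (neg s) ↔ Plain s := Iff.rfl
/-- (structural lemma) [folklore] -/
@[simp] theorem plain_sub_iff (s t : Sym V) : Plain (sub s t) ↔ Plain s ∧ Plain t := Iff.rfl
/-- (structural lemma) [folklore] -/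
@[simp] theorem plain_zero : Plain (zero : Sym V) := trivial
/-- (structural lemma) [folklore] -/
@[simp] theorem plain_comm_iff (s t : Sym V) : Plain (comm s t) ↔ Plain s ∧ Plain t := by
  simp only [comm, sub, neg, plain_add_iff, plain_comp_iff, plain_smul_iff]; tauto

/-- (structural lemma) [folklore] -/
theorem plain_sum : ∀ {l : List (Sym V)}, (∀ s ∈ l, Plain s) → Plain (sum l)
  | [], _ => plain_zero
  | [s], h => h s (List.mem_singleton_self s)
  | s :: t :: l, h => by
    rw [sum_cons_cons, plain_add_iff]
    exact ⟨h s List.mem_cons_self,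
      plain_sum (l := t :: l) fun u hu => h u (List.mem_cons_of_mem _ hu)⟩

end PlainSyntax

section AdjSyntax

omit [InnerProductSpace ℝ V] [FiniteDimensional ℝ V] [MeasurableSpace V] [BorelSpace V]

/-- **The adjoint expression** (meaningful on plain expressions; the gain kernels are fixed
points, a junk value never used). [folklore] -/
def adj : Sym V → Sym V
  | bessel b => bessel b
  | lin v => neg (lin v)
  | cmul c => cmul (conj c)
  | conv θ => conv (reflConj θ)
  | gcomm1 b θ => gcomm1 b θ
  | gcomm2 b θ' θ => gcomm2 b θ' θ
  | smul c s => smul (conj c) (adj s)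
  | add s t => add (adj s) (adj t)
  | comp s t => comp (adj t) (adj s)

/-- (structural lemma) [folklore] -/
@[simp] theorem adj_bessel (b : ℝ) : adj (bessel b : Sym V) = bessel b := rfl
/-- (structural lemma) [folklore] -/
@[simp] theorem adj_lin (v : V) : adj (lin v) = neg (lin v) := rfl
/-- (structural lemma) [folklore] -/
@[simp] theorem adj_cmul (c : ℂ) : adj (cmul c : Sym V) = cmul (conj c) := rfl
/-- (structural lemma) [folklore] -/
@[simp] theorem adj_conv (θ : V → ℂ) : adj (conv θ) = conv (reflConj θ) := rfl
/-- (structural lemma) [folklore] -/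
@[simp] theorem adj_smul (c : ℂ) (s : Sym V) : adj (smul c s) = smul (conj c) (adj s) := rfl
/-- (structural lemma) [folklore] -/
@[simp] theorem adj_add (s t : Sym V) : adj (add s t) = add (adj s) (adj t) := rfl
/-- (structural lemma) [folklore] -/
@[simp] theorem adj_comp (s t : Sym V) : adj (comp s t) = comp (adj t) (adj s) := rfl
/-- (structural lemma) [folklore] -/
@[simp] theorem adj_neg (s : Sym V) : adj (neg s) = neg (adj s) := by simp [neg]
/-- (structural lemma) [folklore] -/
@[simp] theorem adj_sub (s t : Sym V) : adj (sub s t) = sub (adj s) (adj t) := by simp [sub]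

/-- The adjoint has the same order. [folklore] -/
theorem ord_adj : ∀ s : Sym V, ord (adj s) = ord s
  | bessel _ => rfl
  | lin _ => rfl
  | cmul _ => rfl
  | conv _ => rfl
  | gcomm1 _ _ => rfl
  | gcomm2 _ _ _ => rfl
  | smul _ s => by simp [ord_adj s]
  | add s t => by simp [ord_adj s, ord_adj t]
  | comp s t => by simp [ord_adj s, ord_adj t, add_comm]

/-- The adjoint of a plain expression is plain. [folklore] -/
theorem Plain.adjoint : ∀ {s : Sym V}, Plain s → Plain (adj s)
  | bessel _, _ => trivial
  | lin _, _ => trivial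
  | cmul _, _ => trivial
  | conv _, _ => trivial
  | gcomm1 _ _, h => h.elim
  | gcomm2 _ _ _, h => h.elim
  | smul _ s, hs => Plain.adjoint (s := s) hs
  | add _ _, ⟨hs, ht⟩ => ⟨Plain.adjoint hs, Plain.adjoint ht⟩
  | comp _ _, ⟨hs, ht⟩ => ⟨Plain.adjoint ht, Plain.adjoint hs⟩

end AdjSyntax

omit [InnerProductSpace ℝ V] [FiniteDimensional ℝ V] in
/-- The adjoint of a certified expression is certified. [folklore] -/
theorem Cert.adjoint : ∀ {s : Sym V}, Cert s → Cert (adj s)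
  | bessel _, _ => trivial
  | lin _, _ => trivial
  | cmul _, _ => trivial
  | conv _, ⟨D, hθ⟩ => ⟨D, hθ.reflConj⟩
  | gcomm1 _ _, h => h
  | gcomm2 _ _ _, h => h
  | smul _ s, hs => Cert.adjoint (s := s) hs
  | add _ _, ⟨hs, ht⟩ => ⟨Cert.adjoint hs, Cert.adjoint ht⟩
  | comp _ _, ⟨hs, ht⟩ => ⟨Cert.adjoint ht, Cert.adjoint hs⟩

omit [FiniteDimensional ℝ V] [MeasurableSpace V] [BorelSpace V] in
/-- `conj (2πi⟪ξ, v⟫) = -2πi⟪ξ, v⟫`. [folklore] -/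
theorem conj_linMul (v ξ : V) : conj (linMul v ξ) = -linMul v ξ := by
  simp only [linMul_apply, map_mul, Complex.conj_ofReal, Complex.conj_I]
  have h2 : conj (2 : ℂ) = 2 := by
    rw [show (2 : ℂ) = ((2 : ℝ) : ℂ) by norm_num, Complex.conj_ofReal]
  rw [h2]
  ring

/-- **The adjoint identity for plain certified expressions**:
`pairing (s.apply F) G = pairing F (s.adj.apply G)` for `F, G ∈ Nice`. [folklore] -/
theorem Plain.pairing_apply : ∀ {s : Sym V}, Plain s → Cert s → ∀ {F G : V → ℂ}, Nice F →
    Nice G → pairing (apply s F) G = pairing F (apply (adj s) G)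
  | bessel b, _, _, F, G, _, _ => by
    rw [apply_bessel, adj_bessel, apply_bessel, pairing_mul_left]
    congr 1; ext ξ; simp
  | lin v, _, _, F, G, _, _ => by
    rw [apply_lin, adj_lin, apply_neg, apply_lin, pairing_mul_left]
    congr 1; ext ξ; rw [conj_linMul]; ring
  | cmul c, _, _, F, G, _, _ => by
    rw [apply_cmul, adj_cmul, apply_cmul, pairing_mul_left]
  | conv θ, _, ⟨D, hθ⟩, F, G, hF, hG => by
    rw [apply_conv, adj_conv, apply_conv, ← adjKer_convKer]
    exact hθ.kerDecay_convKer.pairing_kerOp_left (hF.inH 0) (by simpa using hG.inH 0)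
  | gcomm1 b θ, h, _, _, _, _, _ => h.elim
  | gcomm2 b θ' θ, h, _, _, _, _, _ => h.elim
  | smul c s, hs, hc, F, G, hF, hG => by
    rw [apply_smul, adj_smul, apply_smul, pairing_const_mul_left, pairing_const_mul_right,
      Complex.conj_conj, Plain.pairing_apply (s := s) hs hc hF hG]
  | add s t, ⟨hs, ht⟩, ⟨hcs, hct⟩, F, G, hF, hG => by
    rw [apply_add, adj_add, apply_add,
      pairing_add_left ((hcs.nice_apply hF).inH 0) ((hct.nice_apply hF).inH 0)
        (by simpa using hG.inH 0),
      pairing_add_right (hF.inH 0) (by simpa using (hcs.adjoint.nice_apply hG).inH 0)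
        (by simpa using (hct.adjoint.nice_apply hG).inH 0),
      Plain.pairing_apply hs hcs hF hG, Plain.pairing_apply ht hct hF hG]
  | comp s t, ⟨hs, ht⟩, ⟨hcs, hct⟩, F, G, hF, hG => by
    rw [apply_comp, adj_comp, apply_comp, Plain.pairing_apply hs hcs (hct.nice_apply hF) hG,
      Plain.pairing_apply ht hct hF (hcs.adjoint.nice_apply hG)]

end Sym

end Literature.Analysis.Hypoelliptic
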